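import Literature.MathematicalPhysics.QuantumFieldTheory.Balaban1983to89.B6SectAScalarModelV1
import Literature.MathematicalPhysics.QuantumFieldTheory.Balaban1983to89.B6Eq250

/-!
# `Balaban1983to89.B6Eq238LocalInverseV1` — T. Bałaban, *Propagators and renormalization transformations for lattice gauge
# theories. II*, Commun. Math. Phys. **96** (1984) 223–250 [Balaban1984PropagatorsII], p. 229 (2.37)–(2.38) and p. 228
# ON THE V1 MULTI-LEVEL TORUS CALCULUS: the LOCAL INVERSES `G′(□)` (*"an inverse of Δ′_a with some boundary conditions on
# the boundary of □"*) and `G(Ω) = (Δ_a↾_Ω)⁻¹ = (ΩΔ_aΩ)⁻¹` CONSTRUCTED for the CONCRETE positive definite `Δ′_a` (p254786)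
# and `Δ_a` (gen 5) — every cube / domain, every nested family, `c ≠ 0`, `a > 0` — and the random-walk generator identity
# **(2.38) `Δ′_aG′₀ = I − Σ_□ K(h_□)G′(□)h_□`** for **(2.37) `G′₀ = Σ_□ h_□G′(□)h_□`**, for EVERY family of cut-offs with
# `Σ_□ h_□² = 1` supported in the cubes (r03's ring identity `…B6SectA.generator238` with both hypotheses DISCHARGED)

statement-level skeleton of published theorems with citation tags; proofs where landed; nothing here is a claim about the
Yang–Mills mass gap

PDF held: `paper:balaban1984-cmp96-propagators-rt-ii` (journal page = PDF page + 222); pp. 228–229 read AS IMAGES on the ×2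
renders `run/shared/lean/pub/pub-balaban/b2b-balaban-ref1/pages/1984-cmp96-propagators-rt-II/…-p006/p007-x2.png` (this seat).

CITATION HEADER (lean-in-tree rule).  Cell `lit-balaban` (HOME `run/shared/lean/pub/lit-balaban/`), PHASE-2 proof seat **p21**
(gen 6), B6 fold owner r03, referee ref-4.  WHAT IS REPRODUCED: SKELETON row **B6.Eq2.37** ((2.37)–(2.38)) and the p. 228
sentence *"denoting G(Ω) = (Δ_a↾_Ω)⁻¹ = (ΩΔ_aΩ)⁻¹"* of row **B6.Txt@228** — KIND model instance: the abstract theorems of record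
are r03's `…B6SectA.generator238` (p238845; (2.38) in any ring under `Σ h_□² = 1` and `h_□Δ′_aG′(□)h_□ = h_□²`) with
`K(h) = hΔ′_a − Δ′_ah` = `…B6Eq250.kOp` (its explicit lattice form (2.39) is r03's `…B6Eq239Commutator`), and r03's
`…B6GOmegaCritical` (p246565; the `G(Ω)`-variant over abstract carriers, `G(Ω)` a hypothesis with `hG`/`hG'`/`hGΩ`/`hΩG`/`hGs`);
here the local inverses are CONSTRUCTED for this seat's concrete `Δ′_a = …B6SectAScalarModelV1.deltaPE` and
`Δ_a = …B6SectAVectorModelV1.deltaAE` on the V1 calculus and the hypotheses are proved.  READING (displayed): the boundary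
condition.  Print leaves it open (*"some boundary conditions … e.g. with Neumann boundary conditions as in [3]"*); the identity
(2.38) only needs `Δ′_aG′(□) = I` on the support of `h_□`, away from `∂□`.  We take the DIRICHLET-type choice `G′(□) :=
(□Δ′_a□)⁻¹` on `ℓ²(□)` (extended by `0`), exactly the construction print uses for `G(Ω)` on p. 228; for it `□Δ′_aG′(□) = □`.
Nothing of the abstract files is restated.

PRINT (p. 229, verbatim): *"Let us consider at first the operator G′. We construct a random walk expansion of it in a similar
way as in [3]. We define G′₀ = Σ_□ h_□G′(□)h_□, (2.37) where G′(□) is an inverse of Δ′_a with some boundary conditions on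
the boundary of □, e.g. with Neumann boundary conditions as in [3]. Repeating the calculations in the paper we get Δ′_aG′₀ =
I − Σ_□ K(h_□)G′(□)h_□ = I − R, (2.38) where (K(h)λ)(x) = … (2.39)"*; p. 229 before (2.36): *"They satisfy Σ_{□∈𝒟} h_□² = 1.
(2.36)"*; p. 228: *"Solving critical point equations for h(A, λ, ω) and denoting G(Ω) = (Δ_a↾_Ω)⁻¹ = (ΩΔ_aΩ)⁻¹, we get …"*.

WHAT IS PROVED (0 sorry, 0 new named facts; axioms standard).  §1 GENERIC (finite-dimensional real inner-product space `E`;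
`S` symmetric positive definite, `P` a symmetric idempotent cut-off): `locAux S P = PSP + (1 − P)` is injective
(`locAux_injective`); **`locInv` := `P(PSP + (1 − P))⁻¹P`**: `P ∘ locInv = locInv ∘ P = locInv`, **`P ∘ S ∘ locInv = P`**,
**`locInv ∘ S ∘ P = P`**, symmetric (`inner_locInv_left`), `⟨y, locInv y⟩ ≥ 0`, `> 0` iff `Py ≠ 0`.  §2 on `L²(T_η)` of the V1
calculus: multiplication operators `mulE h` and cut-offs `cutE □` (symmetric, idempotent, `mulE h ∘ cutE □ = mulE h` when
`supp h ⊆ □`).  §3 **`GpLoc □` = G′(□)** for the concrete `Δ′_a` (every finite set `□` of fine sites, `c ≠ 0`, `w > 0`):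
`□Δ′_aG′(□) = □`, `G′(□)Δ′_a□ = □`, `G′(□) = □G′(□) = G′(□)□`, symmetric, positive on `ℓ²(□)`; the local-inverse hypothesis of
`generator238` **`h_□Δ′_aG′(□)h_□ = h_□²`** (`mul_deltaPE_GpLoc_mul`); **(2.37) `Gp0`** and **(2.38) `eq238_V1`**
(`Δ′_a ∘ G′₀ = 1 − Σ_□ kOp Δ′_a h_□ ∘ G′(□) ∘ h_□`) for every finite family `(□_i, h_i)` with `Σ_i h_i(x)² = 1` for all `x` and
`h_i = 0` off `□_i`; `eq238_V1_apply` (pointwise).  §4 **`GOmegaE Ω` = G(Ω) = (ΩΔ_aΩ)⁻¹** for gen 5's vector `Δ_a` and every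
set `Ω` of fine bonds: `ΩΔ_aG(Ω) = Ω`, `G(Ω)Δ_aΩ = Ω` (r03's `hG'`/`hG` in operator form), `G(Ω)Ω = ΩG(Ω) = G(Ω)` (`hGΩ`/`hΩG`),
symmetric (`hGs`), positive on the `Ω`-fields.
-/

open scoped InnerProductSpace

namespace Literature.MathematicalPhysics.QuantumFieldTheory.Balaban1983to89.B6Eq238LocalInverseV1

open LatticeFieldCalculus B6SectADomainsV1 B6SectAOperatorsV1 B6SectAVectorModelV1 B6SectAScalarModelV1
open BalabanImbrieJaffe1984to88.BIJ85AxialPropagator411 (BondSpace PlaqSpace)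

noncomputable section

/-! ## §1. Generic: the compression inverse `P(PSP + (1 − P))⁻¹P` of a positive definite `S` -/

section Generic

variable {E : Type*} [NormedAddCommGroup E] [InnerProductSpace ℝ E]
variable (S P : E →ₗ[ℝ] E)

/-- the auxiliary operator `PSP + (1 − P)` (= `Δ′_a↾_□` on `ℓ²(□)`, the identity on `ℓ²(□ᶜ)`). [cite: Balaban1984PropagatorsII, (2.37) p.229 + p.228 (G(Ω))] -/
def locAux : E →ₗ[ℝ] E := P ∘ₗ S ∘ₗ P + (LinearMap.id - P)

/-- unfolding. [cite: Balaban1984PropagatorsII, (2.37) p.229] -/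
theorem locAux_apply (x : E) : locAux S P x = P (S (P x)) + (x - P x) := rfl

variable {S P}
variable (hS : ∀ x : E, x ≠ 0 → 0 < ⟪x, S x⟫_ℝ) (hSs : ∀ x y : E, ⟪S x, y⟫_ℝ = ⟪x, S y⟫_ℝ)
  (hP2 : ∀ x : E, P (P x) = P x) (hPs : ∀ x y : E, ⟪P x, y⟫_ℝ = ⟪x, P y⟫_ℝ)

include hS hP2 hPs in
/-- `PSP + (1 − P)` is injective for `S` positive definite and `P` a symmetric idempotent: the compression `PSP` is positive
definite on `ran P` (*"Δ′_a satisfies the inequality (2.11) for all λ"* restricted to `ℓ²(□)`). [cite: Balaban1984PropagatorsII, (2.37) p.229 + p.228 (G(Ω))] -/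
theorem locAux_injective : Function.Injective (locAux S P) := by
  refine (injective_iff_map_eq_zero _).mpr fun x hx => ?_
  rw [locAux_apply] at hx
  have hPx : P (S (P x)) = 0 := by
    have := congrArg P hx
    rwa [map_add, map_sub, hP2, hP2, sub_self, add_zero, map_zero] at this
  have hu : P x = 0 := by
    by_contra hne
    have hpos := hS (P x) hne
    rw [hPs, hPx, inner_zero_right] at hpos
    exact lt_irrefl 0 hpos
  rw [hPx, zero_add, hu, sub_zero] at hx
  exact hx

variable [FiniteDimensional ℝ E]

/-- **the compression inverse** `G_P := P(PSP + (1 − P))⁻¹P` — for `P` = the cut-off to a cube `□` and `S = Δ′_a` this is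
`G′(□) = (Δ′_a↾_□)⁻¹` (Dirichlet-type boundary conditions), for `S = Δ_a` and `P` = the cut-off to `Ω` it is p. 228's
`G(Ω) = (Δ_a↾_Ω)⁻¹ = (ΩΔ_aΩ)⁻¹`. [cite: Balaban1984PropagatorsII, (2.37) p.229 + p.228 (G(Ω))] -/
def locInv : E →ₗ[ℝ] E :=
  P ∘ₗ ((LinearEquiv.ofInjectiveEndo (locAux S P) (locAux_injective hS hP2 hPs)).symm : E →ₗ[ℝ] E) ∘ₗ P

include hS hP2 hPs in
/-- the defining property of the inverse: `(PSP + (1 − P))(M⁻¹y) = y`. [cite: Balaban1984PropagatorsII, (2.37) p.229] -/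
private theorem locAux_symm_apply (y : E) :
    locAux S P (((LinearEquiv.ofInjectiveEndo (locAux S P) (locAux_injective hS hP2 hPs)).symm : E →ₗ[ℝ] E) y) = y :=
  (LinearEquiv.ofInjectiveEndo _ (locAux_injective hS hP2 hPs)).apply_symm_apply y

include hS hP2 hPs in
/-- for `y`, the vector `z := (PSP + (1 − P))⁻¹(Py)` lies in `ran P` and solves `PS z = Py`. [cite: Balaban1984PropagatorsII, (2.37) p.229] -/
private theorem aux_solution (y : E) :
    P (((LinearEquiv.ofInjectiveEndo (locAux S P) (locAux_injective hS hP2 hPs)).symm : E →ₗ[ℝ] E) (P y)) =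
      ((LinearEquiv.ofInjectiveEndo (locAux S P) (locAux_injective hS hP2 hPs)).symm : E →ₗ[ℝ] E) (P y) ∧
    P (S (((LinearEquiv.ofInjectiveEndo (locAux S P) (locAux_injective hS hP2 hPs)).symm : E →ₗ[ℝ] E) (P y))) = P y := by
  set z := ((LinearEquiv.ofInjectiveEndo (locAux S P) (locAux_injective hS hP2 hPs)).symm : E →ₗ[ℝ] E) (P y) with hz
  have hMz : P (S (P z)) + (z - P z) = P y := by rw [← locAux_apply]; exact locAux_symm_apply hS hP2 hPs (P y)
  have h1 : P (S (P z)) = P y := by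
    have := congrArg P hMz
    rwa [map_add, map_sub, hP2, hP2, sub_self, add_zero, hP2] at this
  have h2 : P z = z := by
    have : z - P z = 0 := by rw [h1] at hMz; exact add_eq_left.mp hMz
    exact (sub_eq_zero.mp this).symm
  refine ⟨h2, ?_⟩
  rw [← h1, h2]

/-- `G_P y = (PSP + (1 − P))⁻¹(Py)` (the outer `P` is absorbed). [cite: Balaban1984PropagatorsII, (2.37) p.229] -/
theorem locInv_apply (y : E) :
    locInv hS hP2 hPs y =
      ((LinearEquiv.ofInjectiveEndo (locAux S P) (locAux_injective hS hP2 hPs)).symm : E →ₗ[ℝ] E) (P y) := by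
  rw [locInv, LinearMap.comp_apply, LinearMap.comp_apply]
  exact (aux_solution hS hP2 hPs y).1

/-- `P ∘ G_P = G_P` (`G_P` maps into `ran P`: *"ΩG(Ω) = G(Ω)"*). [cite: Balaban1984PropagatorsII, p.228 (G(Ω)) + (2.37) p.229] -/
theorem P_locInv (y : E) : P (locInv hS hP2 hPs y) = locInv hS hP2 hPs y := by
  rw [locInv_apply]; exact (aux_solution hS hP2 hPs y).1

/-- `G_P ∘ P = G_P` (`G_P` only sees `ran P`: *"G(Ω)Ω = G(Ω)"*). [cite: Balaban1984PropagatorsII, p.228 (G(Ω)) + (2.37) p.229] -/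
theorem locInv_P (y : E) : locInv hS hP2 hPs (P y) = locInv hS hP2 hPs y := by
  rw [locInv_apply, locInv_apply, hP2]

/-- **`PSG_P = P`**: `G_P` inverts `S` on `ran P` from the right, seen through `P` (*"(Δ_a↾_Ω)⁻¹"*).
[cite: Balaban1984PropagatorsII, p.228 (G(Ω)) + (2.37)–(2.38) p.229] -/
theorem P_S_locInv (y : E) : P (S (locInv hS hP2 hPs y)) = P y := by
  rw [locInv_apply]; exact (aux_solution hS hP2 hPs y).2

include hSs in
/-- `G_P` is symmetric (`PSP + (1 − P)` is symmetric, hence so is its inverse). [cite: Balaban1984PropagatorsII, p.228 (G(Ω)) + (2.37) p.229] -/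
theorem inner_locInv_left (x y : E) : ⟪locInv hS hP2 hPs x, y⟫_ℝ = ⟪x, locInv hS hP2 hPs y⟫_ℝ := by
  have hMs : ∀ u v : E, ⟪locAux S P u, v⟫_ℝ = ⟪u, locAux S P v⟫_ℝ := fun u v => by
    simp only [locAux_apply, inner_add_left, inner_add_right, inner_sub_left, inner_sub_right]
    rw [hPs, hSs, hPs, hPs]
  set M' := ((LinearEquiv.ofInjectiveEndo (locAux S P) (locAux_injective hS hP2 hPs)).symm : E →ₗ[ℝ] E) with hM'
  have hM's : ∀ u v : E, ⟪M' u, v⟫_ℝ = ⟪u, M' v⟫_ℝ := fun u v => by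
    conv_lhs => rw [← locAux_symm_apply hS hP2 hPs v]
    rw [← hMs, locAux_symm_apply hS hP2 hPs u]
  rw [locInv_apply, locInv_apply, ← hM', ← (aux_solution hS hP2 hPs x).1, hPs, hM's, hPs,
    (aux_solution hS hP2 hPs y).1]

include hSs in
/-- **`G_PSP = P`** (the left-inverse form, by symmetry). [cite: Balaban1984PropagatorsII, p.228 (G(Ω)) + (2.37) p.229] -/
theorem locInv_S_P (y : E) : locInv hS hP2 hPs (S (P y)) = P y := by
  refine ext_inner_right ℝ fun v => ?_
  rw [inner_locInv_left hS hSs hP2 hPs, hSs, hPs, P_S_locInv, ← hPs]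

/-- `⟨y, G_Py⟩ = ⟨z, Sz⟩` with `z = G_Py` (so `≥ 0`). [cite: Balaban1984PropagatorsII, p.228 (G(Ω)) + (2.37) p.229] -/
theorem inner_locInv_self (y : E) :
    ⟪y, locInv hS hP2 hPs y⟫_ℝ = ⟪locInv hS hP2 hPs y, S (locInv hS hP2 hPs y)⟫_ℝ := by
  set z := locInv hS hP2 hPs y with hz
  have hPz : P z = z := P_locInv hS hP2 hPs y
  calc ⟪y, z⟫_ℝ = ⟪y, P z⟫_ℝ := by rw [hPz]
    _ = ⟪P y, z⟫_ℝ := by rw [hPs]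
    _ = ⟪P (S z), z⟫_ℝ := by rw [P_S_locInv hS hP2 hPs]
    _ = ⟪S z, P z⟫_ℝ := by rw [hPs]
    _ = ⟪z, S z⟫_ℝ := by rw [hPz, real_inner_comm]

/-- `G_P` is positive semi-definite … [cite: Balaban1984PropagatorsII, p.228 (G(Ω)) + (2.37) p.229] -/
theorem inner_locInv_self_nonneg (y : E) : 0 ≤ ⟪y, locInv hS hP2 hPs y⟫_ℝ := by
  rw [inner_locInv_self hS hP2 hPs]
  by_cases h : locInv hS hP2 hPs y = 0
  · rw [h, inner_zero_left]
  · exact (hS _ h).le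

/-- … and positive definite on `ran P`: `⟨y, G_Py⟩ > 0` whenever `Py ≠ 0`. [cite: Balaban1984PropagatorsII, p.228 (G(Ω)) + (2.37) p.229] -/
theorem inner_locInv_self_pos {y : E} (hy : P y ≠ 0) : 0 < ⟪y, locInv hS hP2 hPs y⟫_ℝ := by
  rw [inner_locInv_self hS hP2 hPs]
  refine hS _ fun h => hy ?_
  rw [← P_S_locInv hS hP2 hPs y, h, map_zero, map_zero]

end Generic

/-! ## §2. Multiplication operators and cut-offs on `L²(T_η)` -/

section V1

variable {P : Params} (D : Domains P)

/-- the multiplication operator `λ ↦ hλ` by a function `h` on the fine torus (the `h_□` of (2.36)–(2.37)).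
[cite: Balaban1984PropagatorsII, (2.36)–(2.37) p.229] -/
def mulE (h : Site P 0 → ℝ) : ScalarSpace P →ₗ[ℝ] ScalarSpace P := onE (diagFn h)

/-- `(hλ)(x) = h(x)λ(x)`. [cite: Balaban1984PropagatorsII, (2.37) p.229] -/
@[simp] theorem mulE_apply (h : Site P 0 → ℝ) (f : ScalarSpace P) (x : Site P 0) : mulE h f x = h x * f x := rfl

/-- multiplication operators are symmetric. [cite: Balaban1984PropagatorsII, (2.37) p.229] -/
theorem inner_mulE_left (h : Site P 0 → ℝ) (f g : ScalarSpace P) : ⟪mulE h f, g⟫_ℝ = ⟪f, mulE h g⟫_ℝ := by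
  rw [inner_eq_sum, inner_eq_sum]
  exact Finset.sum_congr rfl fun x _ => by rw [mulE_apply, mulE_apply]; ring

/-- the cut-off `□` to a set of fine sites (multiplication by its indicator): `ℓ²(T_η) → ℓ²(□)`. [cite: Balaban1984PropagatorsII, (2.37) p.229 + p.228 (Ω)] -/
def cutE (s : Finset (Site P 0)) : ScalarSpace P →ₗ[ℝ] ScalarSpace P := mulE fun x => if x ∈ s then 1 else 0

/-- componentwise. [cite: Balaban1984PropagatorsII, (2.37) p.229] -/
theorem cutE_apply (s : Finset (Site P 0)) (f : ScalarSpace P) (x : Site P 0) :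
    cutE s f x = if x ∈ s then f x else 0 := by
  rw [cutE, mulE_apply]; split_ifs <;> simp

/-- `□□ = □`. [cite: Balaban1984PropagatorsII, (2.37) p.229] -/
theorem cutE_cutE (s : Finset (Site P 0)) (f : ScalarSpace P) : cutE s (cutE s f) = cutE s f :=
  PiLp.ext fun x => by simp only [cutE_apply]; split_ifs <;> rfl

/-- `□` is symmetric. [cite: Balaban1984PropagatorsII, (2.37) p.229] -/
theorem inner_cutE_left (s : Finset (Site P 0)) (f g : ScalarSpace P) : ⟪cutE s f, g⟫_ℝ = ⟪f, cutE s g⟫_ℝ :=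
  inner_mulE_left _ f g

/-- `h□ = h` when `h` vanishes off `□` (`supp h_□ ⊆ □`). [cite: Balaban1984PropagatorsII, (2.36)–(2.37) p.229] -/
theorem mulE_cutE {h : Site P 0 → ℝ} {s : Finset (Site P 0)} (hs : ∀ x, x ∉ s → h x = 0) (f : ScalarSpace P) :
    mulE h (cutE s f) = mulE h f :=
  PiLp.ext fun x => by
    simp only [mulE_apply, cutE_apply]
    split_ifs with hx
    · rfl
    · rw [hs x hx]; ring

/-- `□h = h` likewise. [cite: Balaban1984PropagatorsII, (2.36)–(2.37) p.229] -/
theorem cutE_mulE {h : Site P 0 → ℝ} {s : Finset (Site P 0)} (hs : ∀ x, x ∉ s → h x = 0) (f : ScalarSpace P) :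
    cutE s (mulE h f) = mulE h f :=
  PiLp.ext fun x => by
    simp only [mulE_apply, cutE_apply]
    split_ifs with hx
    · rfl
    · rw [hs x hx]; ring

/-! ## §3. `G′(□)` for the concrete `Δ′_a`, (2.37) and (2.38) -/

/-- **`G′(□) = (Δ′_a↾_□)⁻¹`** for the concrete multi-level `Δ′_a` (positive definite: `…B6SectAScalarModelV1.deltaPE_pos`) and
ANY finite set `□` of fine sites — *"G′(□) is an inverse of Δ′_a with some boundary conditions on the boundary of □"*
(Dirichlet-type). [cite: Balaban1984PropagatorsII, (2.37) p.229] -/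
def GpLoc {c : ℝ} (hc : c ≠ 0) {w : SiteIdx D → ℝ} (hw : ∀ i, 0 < w i) (s : Finset (Site P 0)) :
    ScalarSpace P →ₗ[ℝ] ScalarSpace P :=
  locInv (S := deltaPE D c w) (P := cutE s) (fun _ hx => deltaPE_pos D hc hw hx) (cutE_cutE s) (inner_cutE_left s)

/-- **`□Δ′_aG′(□) = □`**: `G′(□)` inverts `Δ′_a` inside `□`. [cite: Balaban1984PropagatorsII, (2.37)–(2.38) p.229] -/
theorem cutE_deltaPE_GpLoc {c : ℝ} (hc : c ≠ 0) {w : SiteIdx D → ℝ} (hw : ∀ i, 0 < w i) (s : Finset (Site P 0))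
    (f : ScalarSpace P) : cutE s (deltaPE D c w (GpLoc D hc hw s f)) = cutE s f :=
  P_S_locInv _ _ _ f

/-- `G′(□)Δ′_a□ = □`. [cite: Balaban1984PropagatorsII, (2.37)–(2.38) p.229] -/
theorem GpLoc_deltaPE_cutE {c : ℝ} (hc : c ≠ 0) {w : SiteIdx D → ℝ} (hw : ∀ i, 0 < w i) (s : Finset (Site P 0))
    (f : ScalarSpace P) : GpLoc D hc hw s (deltaPE D c w (cutE s f)) = cutE s f :=
  locInv_S_P _ (inner_deltaPE_left D c w) _ _ f

/-- `□G′(□) = G′(□)` (range in `ℓ²(□)`). [cite: Balaban1984PropagatorsII, (2.37) p.229] -/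
theorem cutE_GpLoc {c : ℝ} (hc : c ≠ 0) {w : SiteIdx D → ℝ} (hw : ∀ i, 0 < w i) (s : Finset (Site P 0))
    (f : ScalarSpace P) : cutE s (GpLoc D hc hw s f) = GpLoc D hc hw s f :=
  P_locInv _ _ _ f

/-- `G′(□)□ = G′(□)`. [cite: Balaban1984PropagatorsII, (2.37) p.229] -/
theorem GpLoc_cutE {c : ℝ} (hc : c ≠ 0) {w : SiteIdx D → ℝ} (hw : ∀ i, 0 < w i) (s : Finset (Site P 0))
    (f : ScalarSpace P) : GpLoc D hc hw s (cutE s f) = GpLoc D hc hw s f :=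
  locInv_P _ _ _ f

/-- `G′(□)` is symmetric … [cite: Balaban1984PropagatorsII, (2.37) p.229] -/
theorem inner_GpLoc_left {c : ℝ} (hc : c ≠ 0) {w : SiteIdx D → ℝ} (hw : ∀ i, 0 < w i) (s : Finset (Site P 0))
    (f g : ScalarSpace P) : ⟪GpLoc D hc hw s f, g⟫_ℝ = ⟪f, GpLoc D hc hw s g⟫_ℝ :=
  inner_locInv_left _ (inner_deltaPE_left D c w) _ _ f g

/-- … and positive on `ℓ²(□)`: `⟨f, G′(□)f⟩ > 0` whenever `□f ≠ 0`. [cite: Balaban1984PropagatorsII, (2.37) p.229] -/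
theorem inner_GpLoc_pos {c : ℝ} (hc : c ≠ 0) {w : SiteIdx D → ℝ} (hw : ∀ i, 0 < w i) (s : Finset (Site P 0))
    {f : ScalarSpace P} (hf : cutE s f ≠ 0) : 0 < ⟪f, GpLoc D hc hw s f⟫_ℝ :=
  inner_locInv_self_pos _ _ _ hf

/-- **the local-inverse hypothesis of r03's `generator238`, DISCHARGED**: `h_□Δ′_aG′(□)h_□ = h_□²` whenever `supp h_□ ⊆ □`
(*"Δ′_aG′(□) = I"* away from `∂□`). [cite: Balaban1984PropagatorsII, (2.37)–(2.38) p.229] -/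
theorem mul_deltaPE_GpLoc_mul {c : ℝ} (hc : c ≠ 0) {w : SiteIdx D → ℝ} (hw : ∀ i, 0 < w i) {h : Site P 0 → ℝ}
    {s : Finset (Site P 0)} (hs : ∀ x, x ∉ s → h x = 0) :
    mulE h ∘ₗ deltaPE D c w ∘ₗ GpLoc D hc hw s ∘ₗ mulE h = mulE h ∘ₗ mulE h := by
  refine LinearMap.ext fun f => ?_
  simp only [LinearMap.comp_apply]
  rw [← mulE_cutE hs (deltaPE D c w _), ← cutE_mulE hs f, GpLoc_cutE, cutE_deltaPE_GpLoc]

variable {ι : Type*} (t : Finset ι) (sq : ι → Finset (Site P 0)) (h : ι → Site P 0 → ℝ)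

/-- **(2.37) `G′₀ = Σ_□ h_□G′(□)h_□`** for the concrete `Δ′_a` and any finite family of cubes `□_i` with cut-offs `h_i`.
[cite: Balaban1984PropagatorsII, (2.37) p.229] -/
def Gp0 {c : ℝ} (hc : c ≠ 0) {w : SiteIdx D → ℝ} (hw : ∀ i, 0 < w i) : ScalarSpace P →ₗ[ℝ] ScalarSpace P :=
  ∑ i ∈ t, mulE (h i) ∘ₗ GpLoc D hc hw (sq i) ∘ₗ mulE (h i)

/-- unfolding of (2.37). [cite: Balaban1984PropagatorsII, (2.37) p.229] -/
theorem Gp0_def {c : ℝ} (hc : c ≠ 0) {w : SiteIdx D → ℝ} (hw : ∀ i, 0 < w i) :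
    Gp0 D t sq h hc hw = ∑ i ∈ t, mulE (h i) ∘ₗ GpLoc D hc hw (sq i) ∘ₗ mulE (h i) := rfl

/-- (2.36) `Σ_□ h_□² = 1` as an operator identity. [cite: Balaban1984PropagatorsII, (2.36) p.229] -/
theorem sum_mulE_mulE (hpart : ∀ x : Site P 0, ∑ i ∈ t, h i x ^ 2 = 1) :
    ∑ i ∈ t, mulE (P := P) (h i) * mulE (h i) = 1 := by
  refine LinearMap.ext fun f => PiLp.ext fun x => ?_
  rw [Module.End.one_apply, LinearMap.sum_apply]
  simp only [WithLp.ofLp_sum, Finset.sum_apply, Module.End.mul_apply, mulE_apply]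
  calc ∑ i ∈ t, h i x * (h i x * f x) = (∑ i ∈ t, h i x ^ 2) * f x := by
        rw [Finset.sum_mul]; exact Finset.sum_congr rfl fun i _ => by ring
    _ = f x := by rw [hpart x, one_mul]

/-- **(2.38) PROVED for the concrete operators**: `Δ′_aG′₀ = I − Σ_□ K(h_□)G′(□)h_□` with `K(h) = hΔ′_a − Δ′_ah`
(`…B6Eq250.kOp`; its explicit lattice form is (2.39)), for EVERY finite family of cubes `□_i` and cut-offs `h_i` with
`Σ_i h_i² = 1` and `supp h_i ⊆ □_i` — r03's ring identity `…B6SectA.generator238` in `End(L²(T_η))` with both hypotheses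
discharged. [cite: Balaban1984PropagatorsII, (2.38) p.229] -/
theorem eq238_V1 {c : ℝ} (hc : c ≠ 0) {w : SiteIdx D → ℝ} (hw : ∀ i, 0 < w i)
    (hpart : ∀ x : Site P 0, ∑ i ∈ t, h i x ^ 2 = 1) (hsupp : ∀ i ∈ t, ∀ x, x ∉ sq i → h i x = 0) :
    deltaPE D c w * Gp0 D t sq h hc hw =
      1 - ∑ i ∈ t, B6Eq250.kOp (deltaPE D c w) (mulE (h i)) * GpLoc D hc hw (sq i) * mulE (h i) := by
  have hG : Gp0 D t sq h hc hw = ∑ i ∈ t, mulE (h i) * GpLoc D hc hw (sq i) * mulE (h i) := by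
    rw [Gp0_def]; rfl
  rw [hG]
  exact B6SectA.generator238 t (fun i => mulE (h i)) (fun i => GpLoc D hc hw (sq i)) (deltaPE D c w)
    (sum_mulE_mulE t h hpart) fun i hi => by
      have := mul_deltaPE_GpLoc_mul D hc hw (hsupp i hi)
      simpa only [Module.End.mul_eq_comp, LinearMap.comp_assoc] using this

/-- (2.38) applied to a function: `Δ′_a(G′₀f) = f − Σ_□ K(h_□)G′(□)(h_□f)`. [cite: Balaban1984PropagatorsII, (2.38) p.229] -/
theorem eq238_V1_apply {c : ℝ} (hc : c ≠ 0) {w : SiteIdx D → ℝ} (hw : ∀ i, 0 < w i)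
    (hpart : ∀ x : Site P 0, ∑ i ∈ t, h i x ^ 2 = 1) (hsupp : ∀ i ∈ t, ∀ x, x ∉ sq i → h i x = 0) (f : ScalarSpace P) :
    deltaPE D c w (Gp0 D t sq h hc hw f) =
      f - ∑ i ∈ t, B6Eq250.kOp (deltaPE D c w) (mulE (h i)) (GpLoc D hc hw (sq i) (mulE (h i) f)) := by
  have := LinearMap.congr_fun (eq238_V1 D t sq h hc hw hpart hsupp) f
  simpa only [Module.End.mul_apply, LinearMap.sub_apply, Module.End.one_apply, LinearMap.sum_apply] using this

/-! ## §4. `G(Ω) = (Δ_a↾_Ω)⁻¹ = (ΩΔ_aΩ)⁻¹` for gen 5's vector `Δ_a` -/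

/-- the cut-off `Ω` on bond fields (restriction to a set `Ω` of fine bonds; p. 224 *"Ω also the set of bonds"*).
[cite: Balaban1984PropagatorsII, p.224 (sets of bonds) + p.228 (Ω)] -/
def cutB (Ω : PBond P 0 → Prop) [DecidablePred Ω] : BondSpace P →ₗ[ℝ] BondSpace P :=
  onE (diagFn fun b => if Ω b then 1 else 0)

/-- componentwise. [cite: Balaban1984PropagatorsII, p.228 (Ω)] -/
theorem cutB_apply (Ω : PBond P 0 → Prop) [DecidablePred Ω] (x : BondSpace P) (b : PBond P 0) :
    cutB Ω x b = if Ω b then x b else 0 := by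
  change (if Ω b then (1 : ℝ) else 0) * x b = _
  split_ifs <;> simp

/-- `ΩΩ = Ω`. [cite: Balaban1984PropagatorsII, p.228 (Ω)] -/
theorem cutB_cutB (Ω : PBond P 0 → Prop) [DecidablePred Ω] (x : BondSpace P) : cutB Ω (cutB Ω x) = cutB Ω x :=
  PiLp.ext fun b => by simp only [cutB_apply]; split_ifs <;> rfl

/-- `Ω` is symmetric. [cite: Balaban1984PropagatorsII, p.228 (Ω)] -/
theorem inner_cutB_left (Ω : PBond P 0 → Prop) [DecidablePred Ω] (x y : BondSpace P) :
    ⟪cutB Ω x, y⟫_ℝ = ⟪x, cutB Ω y⟫_ℝ := by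
  rw [inner_eq_sum, inner_eq_sum]
  exact Finset.sum_congr rfl fun b _ => by rw [cutB_apply, cutB_apply]; split_ifs <;> ring

/-- **`G(Ω) = (Δ_a↾_Ω)⁻¹ = (ΩΔ_aΩ)⁻¹`** for the concrete `Δ_a` of (2.19) (positive definite, gen 5's `deltaAE_pos`) and EVERY set
`Ω` of fine bonds (p. 228 *"denoting G(Ω) = (Δ_a↾_Ω)⁻¹ = (ΩΔ_aΩ)⁻¹"*; the `G` of r03's `…B6GOmegaCritical`).
[cite: Balaban1984PropagatorsII, p.228 (G(Ω))] -/
def GOmegaE {c : ℝ} (hc : c ≠ 0) {w : BondIdx D → ℝ} (hw : ∀ i, 0 < w i) (Ω : PBond P 0 → Prop) [DecidablePred Ω] :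
    BondSpace P →ₗ[ℝ] BondSpace P :=
  locInv (S := deltaAE D c w) (P := cutB Ω) (fun _ hx => deltaAE_pos D hc hw hx) (cutB_cutB Ω) (inner_cutB_left Ω)

/-- **`ΩΔ_aG(Ω) = Ω`** (r03's `hG'` in operator form). [cite: Balaban1984PropagatorsII, p.228 (G(Ω))] -/
theorem cutB_deltaAE_GOmegaE {c : ℝ} (hc : c ≠ 0) {w : BondIdx D → ℝ} (hw : ∀ i, 0 < w i) (Ω : PBond P 0 → Prop)
    [DecidablePred Ω] (x : BondSpace P) : cutB Ω (deltaAE D c w (GOmegaE D hc hw Ω x)) = cutB Ω x :=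
  P_S_locInv _ _ _ x

/-- **`G(Ω)Δ_aΩ = Ω`**, i.e. `G(Ω)(Δ_a(Ωy)) = Ωy` (r03's `hG`). [cite: Balaban1984PropagatorsII, p.228 (G(Ω))] -/
theorem GOmegaE_deltaAE_cutB {c : ℝ} (hc : c ≠ 0) {w : BondIdx D → ℝ} (hw : ∀ i, 0 < w i) (Ω : PBond P 0 → Prop)
    [DecidablePred Ω] (y : BondSpace P) : GOmegaE D hc hw Ω (deltaAE D c w (cutB Ω y)) = cutB Ω y :=
  locInv_S_P _ (inner_deltaAE_left D c w) _ _ y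

/-- `ΩG(Ω) = G(Ω)` (r03's `hΩG`). [cite: Balaban1984PropagatorsII, p.228 (G(Ω))] -/
theorem cutB_GOmegaE {c : ℝ} (hc : c ≠ 0) {w : BondIdx D → ℝ} (hw : ∀ i, 0 < w i) (Ω : PBond P 0 → Prop)
    [DecidablePred Ω] (x : BondSpace P) : cutB Ω (GOmegaE D hc hw Ω x) = GOmegaE D hc hw Ω x :=
  P_locInv _ _ _ x

/-- `G(Ω)Ω = G(Ω)` (r03's `hGΩ`). [cite: Balaban1984PropagatorsII, p.228 (G(Ω))] -/
theorem GOmegaE_cutB {c : ℝ} (hc : c ≠ 0) {w : BondIdx D → ℝ} (hw : ∀ i, 0 < w i) (Ω : PBond P 0 → Prop)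
    [DecidablePred Ω] (x : BondSpace P) : GOmegaE D hc hw Ω (cutB Ω x) = GOmegaE D hc hw Ω x :=
  locInv_P _ _ _ x

/-- `G(Ω)` is symmetric (r03's `hGs`) … [cite: Balaban1984PropagatorsII, p.228 (G(Ω))] -/
theorem inner_GOmegaE_left {c : ℝ} (hc : c ≠ 0) {w : BondIdx D → ℝ} (hw : ∀ i, 0 < w i) (Ω : PBond P 0 → Prop)
    [DecidablePred Ω] (x y : BondSpace P) : ⟪GOmegaE D hc hw Ω x, y⟫_ℝ = ⟪x, GOmegaE D hc hw Ω y⟫_ℝ :=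
  inner_locInv_left _ (inner_deltaAE_left D c w) _ _ x y

/-- … and positive on the `Ω`-fields: `⟨x, G(Ω)x⟩ > 0` whenever `Ωx ≠ 0`. [cite: Balaban1984PropagatorsII, p.228 (G(Ω))] -/
theorem inner_GOmegaE_pos {c : ℝ} (hc : c ≠ 0) {w : BondIdx D → ℝ} (hw : ∀ i, 0 < w i) (Ω : PBond P 0 → Prop)
    [DecidablePred Ω] {x : BondSpace P} (hx : cutB Ω x ≠ 0) : 0 < ⟪x, GOmegaE D hc hw Ω x⟫_ℝ :=
  inner_locInv_self_pos _ _ _ hx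

end V1

end

end Literature.MathematicalPhysics.QuantumFieldTheory.Balaban1983to89.B6Eq238LocalInverseV1
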